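import Summits.FinalStateConjecture.FinalStateConjecture.Theorems.BartnikGapSettlingBondiBartnikRigidityRouteMarchingDefs
import Summits.FinalStateConjecture.FinalStateConjecture.Theorems.BartnikGapSettlingBondiBartnikRigiditySlabCauchyRigidityFactorisation
import Literature.Geometry.Lorentzian.KerrSchildChartCovariance
import Literature.Geometry.Lorentzian.KerrHyperboloidalLeaves
import HarnessLib

/-!
# K2b-5 `stub_marchingLemma`, brick 9: an isometric embedding of an open Kerr-side set is an EXACT CHART
# of the collar background — line `direct-method-on-the-cone` (crux `BondiBartnikRigidity`,
# stmt-FinalStateConjecture-10807)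

Chart plumbing of one marching step (the kite piece): a smooth, time-orientation preserving, isometric open
embedding `Θ : U → 𝒮` of an open sub-spacetime `U` of the Kerr star chart `Kerr.spacetime M a M` (in the
marching: the realised kite, `KiteRealise.kite_realised`) read through the rest-frame identification
`x ↦ Λ⁻¹(x − c)` of the collar background `B = starBackground Λ c M a (r_a ∘ (Λ,c)⁻¹)` IS an exact chart
on `pullK U` in the sense of the route files: smooth, an open embedding, deviation `0`, pushing the
Kerr-star orientation `ΛV` to future-directed vectors (`chart_of_isometricEmbedding`).  This is the block
"the chart `Ψ`" of `F1Route.slabCauchyRigidity'_of_route` (module `…SlabCauchyRigidity.lean`), verbatim up to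
the replacement of the lens by `U` and of `χ` by `Θ`, plus the orientation clause.

References: O'Neill 1983, Ch. 3, pp. 90–91 [ONeill1983]; Dafermos–Rodnianski arXiv:0811.0354, §5.1
[DafermosRodnianski2008].  No definitions, no named facts.
-/

noncomputable section

-- D-0017: single-problem summit, `Summit.<S>.<S>.…` by design (cf. lakefile `weak.linter.dupNamespace`).
set_option linter.dupNamespace false
set_option maxSynthPendingDepth 3

open Set Filter Function Topology TopologicalSpace Bundle
open Literature.Geometry.Lorentzian
open scoped Manifold ContDiff Topology ENNReal

namespace Summit.FinalStateConjecture.FinalStateConjecture.Theorems.BondiBartnikRigidity.DirectMethod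

namespace KiteChart

open F1Route (lab_poincareInv poincareInv_lab poincareInv_injective supCkENorm_zero_le_of_forall_eq_zero)

set_option maxHeartbeats 1600000 in
-- adapted from `Theorems/BartnikGapSettlingBondiBartnikRigiditySlabCauchyRigidity.lean`
-- (`slabCauchyRigidity'_of_route`, block "the chart `Ψ`")
/-- **An isometric embedding of an open Kerr-side set is an exact chart of the collar background.**
Let `U` be an open sub-spacetime of the Kerr star chart and `Θ : U → 𝒮` a smooth, time-orientation
preserving, isometric open embedding.  Then `Ψ x = Θ (Λ⁻¹(x − c))` (junk `Ψ₀ x` off `pullK U`) is smooth on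
`pullK U`, an open embedding of it, has deviation `0` from the collar background there, pushes `ΛV` to
future-directed vectors, and reads `Θ` back: `Ψ (Λ z + c) = Θ z`. [cite: ONeill1983, Ch. 3, pp. 90–91] -/
theorem chart_of_isometricEmbedding [Kerr.Facts] {𝒮 : Spacetime.{0} 4} {mo : lorentzGroup × E4} {M a : ℝ}
    (hM : 0 < M) {B : ModelBackground}
    (hB : B = starBackground mo.1 mo.2 M a (fun x => Kerr.radius a (poincareInv mo.1 mo.2 x)))
    (U : Opens (Kerr.spacetime M a M hM.le).carrier) {Θ : U → 𝒮.carrier}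
    (hΘs : ContMDiff 𝓘(ℝ, E4) (𝓡 4) ∞ Θ) (hΘo : IsOpenEmbedding Θ)
    (hΘi : ((Kerr.spacetime M a M hM.le).metric.restrict PseudoRiemannianMetric.contMDiff_restrict_holds
        U).IsIsometricImmersion 𝒮.metric.toPseudoRiemannianMetric Θ)
    (hΘt : ((Kerr.spacetime M a M hM.le).timeOrientation.restrict PseudoRiemannianMetric.contMDiff_restrict_holds
        (Kerr.spacetime M a M hM.le).timeOrientation.contMDiff_restrict_holds U).PreservesTimeOrientation
        Θ 𝒮.timeOrientation)
    (Ψ₀ : B.domain → 𝒮.carrier) :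
    ∃ Ψ : B.domain → 𝒮.carrier,
      ContMDiffOn 𝓘(ℝ, E4) (𝓡 4) ∞ Ψ (pullK mo M a B (U : Set (Kerr.spacetime M a M hM.le).carrier)) ∧
      IsOpenEmbedding ((pullK mo M a B (U : Set (Kerr.spacetime M a M hM.le).carrier)).restrict Ψ) ∧
      supCkENorm (Subtype.val '' pullK mo M a B (U : Set (Kerr.spacetime M a M hM.le).carrier)) 0
        (𝒮.deviationExtend B Ψ) ≤ 0 ∧
      (∀ x ∈ pullK mo M a B (U : Set (Kerr.spacetime M a M hM.le).carrier), 𝒮.timeOrientation.IsFutureDirected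
        (mfderiv 𝓘(ℝ, E4) (𝓡 4) Ψ x ((mo.1 : E4 ≃L[ℝ] E4) (Kerr.timeVector M a (poincareInv mo.1 mo.2 x.1))))) ∧
      (∀ (z : Kerr.region a M) (hz : z ∈ U) (x : B.domain), (x.1 : E4) = (mo.1 : E4 ≃L[ℝ] E4) z.1 + mo.2 →
        Ψ x = Θ ⟨z, hz⟩) ∧
      (∀ x, x ∉ pullK mo M a B (U : Set (Kerr.spacetime M a M hM.le).carrier) → Ψ x = Ψ₀ x) := by
  set US : Set (Kerr.region a M) := (U : Set (Kerr.spacetime M a M hM.le).carrier) with hUS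
  have hUo : IsOpen US := U.2
  /- ### the rest-frame map `P = Λ⁻¹(· − c)` from the background domain onto the Kerr chart -/
  set P : E4 → E4 := poincareInv mo.1 mo.2 with hP
  have hdom : (B.domain : Set E4) = P ⁻¹' (Kerr.region a M : Set E4) := by rw [hB]; rfl
  have hbil : B.bilin = boostedKerrBilin mo.1 mo.2 M a := by rw [hB]; rfl
  have hPreg : ∀ x : B.domain, P x.1 ∈ Kerr.region a M := fun x => by
    have hx : (x.1 : E4) ∈ (B.domain : Set E4) := x.2
    rw [hdom] at hx
    exact hx
  set Pr : B.domain → Kerr.region a M := fun x => ⟨P x.1, hPreg x⟩ with hPr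
  have hPrs : ContMDiff 𝓘(ℝ, E4) 𝓘(ℝ, E4) ∞ Pr := by
    rw [← ContMDiff.subtypeVal_comp_iff]
    intro x
    exact contMDiffAt_subtype_iff.2 (KerrSchildChart.contDiff_poincareInv mo.1 mo.2).contMDiff.contMDiffAt
  have hdPr : ∀ x : B.domain, mfderiv 𝓘(ℝ, E4) 𝓘(ℝ, E4) Pr x = ((mo.1 : E4 ≃L[ℝ] E4).symm : E4 →L[ℝ] E4) := fun x => by
    have h1 : MDifferentiableAt 𝓘(ℝ, E4) 𝓘(ℝ, E4) (fun x : B.domain => P x.1) x := by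
      have := (KerrSchildChart.contDiff_poincareInv mo.1 mo.2 (n := ∞)).contMDiff.contMDiffAt (x := x.1)
      exact (contMDiffAt_subtype_iff.2 this).mdifferentiableAt (by simp)
    rw [OpensChart.mfderiv_codRestrict (f := fun x : B.domain => P x.1) (fun _ => rfl) h1]
    rw [show (fun x : B.domain => P x.1) = P ∘ Subtype.val from rfl,
      mfderiv_comp_subtypeVal (((KerrSchildChart.contDiff_poincareInv mo.1 mo.2 (n := ∞)).contMDiff.contMDiffAt
        (x := x.1)).mdifferentiableAt (by simp)), mfderiv_eq_fderiv, KerrSchildChart.fderiv_poincareInv]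
  have hlab : ∀ z : Kerr.region a M, (mo.1 : E4 ≃L[ℝ] E4) z.1 + mo.2 ∈ B.domain := by
    intro z
    show (mo.1 : E4 ≃L[ℝ] E4) z.1 + mo.2 ∈ (B.domain : Set E4)
    rw [hdom, mem_preimage, show P ((mo.1 : E4 ≃L[ℝ] E4) z.1 + mo.2) = z.1 from poincareInv_lab mo z.1]
    exact z.2
  let PrH : B.domain ≃ₜ Kerr.region a M :=
    { toFun := Pr
      invFun := fun z => ⟨(mo.1 : E4 ≃L[ℝ] E4) z.1 + mo.2, hlab z⟩
      left_inv := fun x => Subtype.ext (lab_poincareInv mo x.1)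
      right_inv := fun z => Subtype.ext (poincareInv_lab mo z.1)
      continuous_toFun := hPrs.continuous
      continuous_invFun := by
        refine Continuous.subtype_mk ?_ _
        exact (((mo.1 : E4 ≃L[ℝ] E4).continuous.comp continuous_subtype_val).add continuous_const) }
  have hpull : pullK mo M a B US = Pr ⁻¹' US := by
    ext x
    exact ⟨fun ⟨_, h⟩ => h, fun h => ⟨hPreg x, h⟩⟩
  /- ### the chart `Ψ` -/
  classical
  have hpullo : IsOpen (Pr ⁻¹' US) := hUo.preimage hPrs.continuous
  let Ψ : B.domain → 𝒮.carrier := fun x => if h : Pr x ∈ U then Θ ⟨Pr x, h⟩ else Ψ₀ x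
  have hΨ_of : ∀ x (h : Pr x ∈ U), Ψ x = Θ ⟨Pr x, h⟩ := fun x h => dif_pos h
  obtain ⟨q₀⟩ : Nonempty 𝒮.carrier := inferInstance
  -- the extension of `Θ` off `U`, for the calculus
  let Θ' : Kerr.region a M → 𝒮.carrier := fun z => if h : z ∈ U then Θ ⟨z, h⟩ else q₀
  have hΘ'U : (fun z : U => Θ' z.1) = Θ := funext fun z => dif_pos z.2
  have hΘ'at : ∀ z : Kerr.region a M, z ∈ U → ContMDiffAt 𝓘(ℝ, E4) (𝓡 4) ∞ Θ' z := fun z hz => by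
    have h : ContMDiffAt 𝓘(ℝ, E4) (𝓡 4) ∞ (fun z : U => Θ' z.1) ⟨z, hz⟩ := by rw [hΘ'U]; exact hΘs ⟨z, hz⟩
    exact contMDiffAt_subtype_iff.1 h
  have hdΘ' : ∀ z : U, mfderiv 𝓘(ℝ, E4) (𝓡 4) Θ z = mfderiv 𝓘(ℝ, E4) (𝓡 4) Θ' z.1 := fun z => by
    rw [← hΘ'U]
    exact mfderiv_comp_subtypeVal ((hΘ'at z.1 z.2).mdifferentiableAt (by simp))
  have hΨeq : ∀ x, Pr x ∈ U → Ψ =ᶠ[𝓝 x] (Θ' ∘ Pr) := fun x hx => by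
    filter_upwards [hpullo.mem_nhds hx] with y hy
    rw [hΨ_of y hy]
    have hy' : Pr y ∈ U := hy
    show Θ ⟨Pr y, hy⟩ = Θ' (Pr y)
    simp only [Θ']
    rw [dif_pos hy']
  have hΨat : ∀ x, Pr x ∈ U → ContMDiffAt 𝓘(ℝ, E4) (𝓡 4) ∞ Ψ x := fun x hx =>
    ((hΘ'at (Pr x) hx).comp x (hPrs x)).congr_of_eventuallyEq (hΨeq x hx)
  have hΨon : ContMDiffOn 𝓘(ℝ, E4) (𝓡 4) ∞ Ψ (Pr ⁻¹' US) :=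
    fun x hx => (hΨat x hx).contMDiffWithinAt
  have hdΨ : ∀ (x : B.domain), Pr x ∈ U → ∀ v : E4, mfderiv 𝓘(ℝ, E4) (𝓡 4) Ψ x v =
      mfderiv 𝓘(ℝ, E4) (𝓡 4) Θ' (Pr x) (((mo.1 : E4 ≃L[ℝ] E4).symm : E4 →L[ℝ] E4) v) := by
    intro x hx v
    rw [(hΨeq x hx).mfderiv_eq, mfderiv_comp x ((hΘ'at (Pr x) hx).mdifferentiableAt (by simp))
      (hPrs.mdifferentiableAt (by simp)), hdPr x]
    rfl
  -- `Θ'` is isometric on `U` (chart form) and preserves the orientation there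
  have hisoΘ' : ∀ (z : Kerr.region a M) (hz : z ∈ U) (u u' : E4),
      𝒮.metric.val (Θ' z) (mfderiv 𝓘(ℝ, E4) (𝓡 4) Θ' z u) (mfderiv 𝓘(ℝ, E4) (𝓡 4) Θ' z u') =
        Kerr.bilin M a z.1 u u' := by
    intro z hz u u'
    have e1 : Θ' z = Θ ⟨z, hz⟩ := dif_pos hz
    have e2 : mfderiv 𝓘(ℝ, E4) (𝓡 4) Θ' z = mfderiv 𝓘(ℝ, E4) (𝓡 4) Θ ⟨z, hz⟩ := (hdΘ' ⟨z, hz⟩).symm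
    have h := congrArg (fun b => b u u') (hΘi.2 ⟨z, hz⟩)
    simp only [pullbackBilin_apply] at h
    rw [e1, e2]
    exact h
  have htopΘ' : ∀ (z : Kerr.region a M) (hz : z ∈ U),
      𝒮.timeOrientation.IsFutureDirected (mfderiv 𝓘(ℝ, E4) (𝓡 4) Θ' z (Kerr.timeVector M a z.1)) := by
    intro z hz
    have e1 : Θ' z = Θ ⟨z, hz⟩ := dif_pos hz
    have e2 : mfderiv 𝓘(ℝ, E4) (𝓡 4) Θ' z = mfderiv 𝓘(ℝ, E4) (𝓡 4) Θ ⟨z, hz⟩ := (hdΘ' ⟨z, hz⟩).symm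
    have h := hΘt ⟨z, hz⟩
    rw [e2]
    have hgen : ∀ q, q = Θ ⟨z, hz⟩ → 𝒮.timeOrientation.IsFutureDirected (x := q)
        (mfderiv 𝓘(ℝ, E4) (𝓡 4) Θ ⟨z, hz⟩ (Kerr.timeVector M a z.1)) := by
      rintro q rfl; exact h
    exact hgen _ e1
  -- exactness of `Ψ` on `pullK U`
  have hexact : ∀ x, Pr x ∈ U → 𝒮.deviation B Ψ x = 0 := by
    intro x hx
    ext v w
    have e1 : Θ' (Pr x) = Θ ⟨Pr x, hx⟩ := dif_pos hx
    rw [Spacetime.deviation_apply, hdΨ x hx v, hdΨ x hx w, hΨ_of x hx, ← e1, hisoΘ' (Pr x) hx, hbil,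
      boostedKerrBilin_apply]
    exact sub_self _
  refine ⟨Ψ, by rw [hpull]; exact hΨon, ?_, ?_, ?_, fun z hz x hxz => ?_, fun x hx => dif_neg (by rwa [hpull] at hx)⟩
  · -- open embedding of `pullK U`
    have hiff : ∀ x : B.domain, x ∈ pullK mo M a B US ↔ PrH x ∈ US := fun x => ⟨fun ⟨_, h⟩ => h, fun h => ⟨hPreg x, h⟩⟩
    let Qd : pullK mo M a B US ≃ₜ US := PrH.subtype hiff
    have hcomp : (pullK mo M a B US).restrict Ψ = Θ ∘ Qd := by
      funext x
      exact hΨ_of x.1 x.2.2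
    rw [hcomp]
    exact hΘo.comp Qd.isOpenEmbedding
  · -- exactness
    refine supCkENorm_zero_le_of_forall_eq_zero ?_
    rintro _ ⟨x, hx, rfl⟩
    rw [Spacetime.deviationExtend_coe]
    exact hexact x (by rw [hpull] at hx; exact hx)
  · -- orientation
    intro x hx
    rw [hpull] at hx
    rw [hdΨ x hx]
    simp only [ContinuousLinearEquiv.coe_coe, ContinuousLinearEquiv.symm_apply_apply]
    have e1 : Θ' (Pr x) = Ψ x := by rw [hΨ_of x hx]; exact dif_pos hx
    have hgen : ∀ q, q = Θ' (Pr x) → 𝒮.timeOrientation.IsFutureDirected (x := q)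
        (mfderiv 𝓘(ℝ, E4) (𝓡 4) Θ' (Pr x) (Kerr.timeVector M a (P x.1))) := by
      rintro q rfl; exact htopΘ' (Pr x) hx
    exact hgen _ e1.symm
  · -- reading `Θ` back: `Ψ (Λ z + c) = Θ z`
    have hPz : Pr x = z := Subtype.ext (by show P x.1 = z.1; rw [hxz]; exact poincareInv_lab mo z.1)
    have hxU : Pr x ∈ US := by rw [hPz]; exact hz
    rw [hΨ_of x hxU]
    congr 1
    exact Subtype.ext hPz

end KiteChart

/-- **Registered bookkeeping sub-goal `stub_pullKMemIff` of the line** (brick of the landing of K2b-5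
`stub_marchingLemma`): membership in the pull-back of a Kerr-side set along the rest-frame map (anchor of this
file, whose content is the exact chart of the collar background defined by an isometric embedding of an open
Kerr-side set, `KiteChart.chart_of_isometricEmbedding`). [folklore] -/
theorem stub_pullKMemIff : ∀ (mo : lorentzGroup × E4) (M a : ℝ) (B : ModelBackground) (S : Set (Kerr.region a M))
    (x : B.domain), x ∈ pullK mo M a B S ↔
      ∃ h : poincareInv mo.1 mo.2 x.1 ∈ Kerr.region a M, (⟨poincareInv mo.1 mo.2 x.1, h⟩ : Kerr.region a M) ∈ S :=
  fun _ _ _ _ _ _ => Iff.rfl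

end Summit.FinalStateConjecture.FinalStateConjecture.Theorems.BondiBartnikRigidity.DirectMethod

end
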